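import Summits.HubbardSuperconductivity.HubbardSuperconductivity.Theorems.BirGroundStateAverageLRO.Negative.SpinCeilingLadder
import Summits.HubbardSuperconductivity.HubbardSuperconductivity.Theorems.BalabanIRBirGroundStateAverageLROBounds

/-!
# Crux `BirGroundStateAverageLRO` (item `stmt-HubbardSuperconductivity-2079`): the spin ceiling — no ground-state-average pair order without a macroscopic spin deficit

Third file of the spin corner of the crux's regime map (route BalabanIR, target / rank 0,
`Theses.BalabanIR.BirGroundStateAverageLRO`: on a window `0 < U₁ < U < U₂`, eventually in even `L`,
`c·L⁴·Re tr P ≤ Re tr (P Δ_d† Δ_d)` for the projection `P` onto the ground eigenspace of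
`hubbardTorus 2 L 1 U` in the sector `(2n, S^z = 0)`, `n = ⌊(1-δ)L²/2⌋`). The operator inequality
`Δ_d† Δ_d ≤ (40 L²/(n+1)) (n(n+1) - S²)` of `SpinCeilingLadder.lean`, averaged over the ground
eigenspace, gives — at EVERY coupling and for ANY Hamiltonian preserving the sector —

* `re_trace_projMatrix_mul_le_of_forall_mem_sub` — the two-operator column expansion
  (`Re ⟨v, A v⟩ ≤ C(a‖v‖² - Re ⟨v, S v⟩)` on `K` gives `Re tr (P_K A) ≤ C(a·Re tr P_K - Re tr (P_K S))`);
* `re_trace_sectorGroundProj_mul_pairField_dWave_le_spinDeficit` (any `H`),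
  `re_trace_groundProj_mul_pairField_le_spinDeficit` (the crux's `let` vocabulary):
  `Re tr (P Δ_d† Δ_d) ≤ (40 L²/(n+1)) (n(n+1) Re tr P - Re tr (P S²))`;
* `avgBound_re_trace_spinSq_le` — **if the crux's inequality holds at ONE datum `(δ, U, c, L)`, the
  ground-state average of `S²` is at most `(n+1)(n - cL²/40) · Re tr P`**, i.e. below the saturated
  value `S_max(S_max+1)`, `S_max = n = N/2`, by at least `(S_max+1) c L²/40`; relative form
  `avgBound_spin_deficit`: `Re tr (P S²) ≤ (1 - c/(20(1-δ))) · n(n+1) · Re tr P`;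
* `not_avgBound_of_re_trace_spinSq_gt`, `not_avgBound_of_saturated_groundSpace` — contrapositives: a
  ground space of (on average, nearly) saturated ferromagnets carries NO average `d`-wave pair order
  (the quantitative form of the disprover's §6 `exists_groundState_not_saturated_of_avgBoundAt` and of
  route NoGo's `NoGo.pairField_mulVec_eq_zero_of_saturated`);
* `birGroundStateAverageLRO_witness_spin_deficit` (registered one-line stub `spinWitnessCeiling`,
  `--supports stmt-HubbardSuperconductivity-2079`) — **every witness `(δ, U₁, U₂, c)` of the crux
  forces, at every coupling of its window and eventually in even `L`, a RELATIVE spin deficit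
  `1 - ⟨S²⟩_GS/(S_max(S_max+1)) ≥ c/(20(1-δ))`**; `birGroundStateAverageLRO_spin_deficit` — the
  conditional reading for the route.

Regime map (with `Negative/RegimeMap.lean`, `Negative/PairGapTower.lean`): besides Yang's kinematic
ceiling `c ≤ 2(1-δ²)`, the carrier ceiling `c ≤ 80δ + 640/U₂`, the weak-coupling ceiling
`c ≲ 10⁵ U₁ log²(4 + 32/√U₁)` and the gapless charge-`±2` tower, a witness window must keep the
sector ground states MACROSCOPICALLY below saturation: `⟨S²⟩_GS ≤ (1 - c/(20(1-δ))) S_max(S_max+1)`.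
The spin corner is independent of `U`: it constrains the order functional on high-spin states, and
bites wherever (finite-density Nagaoka-type) ferromagnetism of the `(2n, S^z = 0)` ground states would
hold — an open question at every `(δ, U)` (Tasaki 1998, p. 21).

Sources: H. Tasaki, Prog. Theor. Phys. 99 (1998) 489, pp. 20–21; H. Tasaki (2020) §2.1, §2.4, App. A.2
(ground-state averages, angular momentum); E. H. Lieb, PRL 62 (1989) 1201; D. J. Scalapino, Phys.
Rep. 250 (1995) 329, §2. Folklore finite-dimensional statements; no definition and no named fact is
introduced; nothing here asserts a Theses decl.
-/

noncomputable section

namespace Summit.HubbardSuperconductivity.HubbardSuperconductivity.Theorems.BirGroundStateAverageLRO.Negative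

set_option linter.dupNamespace false

open Matrix Finset Filter
open Literature.Probability.LatticeModels Literature.MathematicalPhysics.QuantumLattice
open Summit.HubbardSuperconductivity.HubbardSuperconductivity.Theorems
open Summit.HubbardSuperconductivity.HubbardSuperconductivity.Theses.BalabanIR
open scoped ComplexOrder

/-! ### Ground-state averages: the crux format -/

section CruxFormat

variable {ν : Type*} [Fintype ν] [DecidableEq ν]

/-- **Average of a two-operator comparison.** If `Re ⟨v, A v⟩ ≤ C (a ‖v‖² - Re ⟨v, S v⟩)` for every
`v ∈ K`, then `Re tr (P_K A) ≤ C (a · Re tr P_K - Re tr (P_K S))` for the projection matrix onto (the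
Euclidean transport of) `K` (column expansion of the three traces, as in `re_trace_projMatrix_mul_le`).
Tasaki (2020) §2.1, App. A.2. [folklore] -/
theorem re_trace_projMatrix_mul_le_of_forall_mem_sub (K : Submodule ℂ (ν → ℂ)) (A S : Matrix ν ν ℂ)
    (C a : ℝ)
    (h : ∀ v ∈ K, (star v ⬝ᵥ A *ᵥ v).re ≤ C * (a * (star v ⬝ᵥ v).re - (star v ⬝ᵥ S *ᵥ v).re)) :
    (projMatrix (K.map ((WithLp.linearEquiv 2 ℂ (ν → ℂ)).symm :
        (ν → ℂ) →ₗ[ℂ] EuclideanSpace ℂ ν)) * A).trace.re ≤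
      C * (a * (projMatrix (K.map ((WithLp.linearEquiv 2 ℂ (ν → ℂ)).symm :
        (ν → ℂ) →ₗ[ℂ] EuclideanSpace ℂ ν))).trace.re -
        (projMatrix (K.map ((WithLp.linearEquiv 2 ℂ (ν → ℂ)).symm :
          (ν → ℂ) →ₗ[ℂ] EuclideanSpace ℂ ν)) * S).trace.re) := by
  rw [trace_projMatrix_mul_eq _ A, trace_conjTranspose_mul_mul_eq_sum, trace_projMatrix_mul_eq _ S,
    trace_conjTranspose_mul_mul_eq_sum, trace_projMatrix_eq, trace_conjTranspose_mul_self_eq_sum,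
    Complex.re_sum, Complex.re_sum, Complex.re_sum]
  calc ∑ i, (star ((projMatrix (K.map ((WithLp.linearEquiv 2 ℂ (ν → ℂ)).symm :
          (ν → ℂ) →ₗ[ℂ] EuclideanSpace ℂ ν)))ᵀ i) ⬝ᵥ A *ᵥ (projMatrix (K.map
          ((WithLp.linearEquiv 2 ℂ (ν → ℂ)).symm : (ν → ℂ) →ₗ[ℂ] EuclideanSpace ℂ ν)))ᵀ i).re
      ≤ ∑ i, C * (a * (star ((projMatrix (K.map ((WithLp.linearEquiv 2 ℂ (ν → ℂ)).symm :
          (ν → ℂ) →ₗ[ℂ] EuclideanSpace ℂ ν)))ᵀ i) ⬝ᵥ (projMatrix (K.map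
          ((WithLp.linearEquiv 2 ℂ (ν → ℂ)).symm : (ν → ℂ) →ₗ[ℂ] EuclideanSpace ℂ ν)))ᵀ i).re -
          (star ((projMatrix (K.map ((WithLp.linearEquiv 2 ℂ (ν → ℂ)).symm :
          (ν → ℂ) →ₗ[ℂ] EuclideanSpace ℂ ν)))ᵀ i) ⬝ᵥ S *ᵥ (projMatrix (K.map
          ((WithLp.linearEquiv 2 ℂ (ν → ℂ)).symm : (ν → ℂ) →ₗ[ℂ] EuclideanSpace ℂ ν)))ᵀ i).re) :=
        Finset.sum_le_sum fun i _ => h _ (transpose_projMatrix_map_mem K i)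
    _ = _ := by rw [Finset.mul_sum, ← Finset.sum_sub_distrib, Finset.mul_sum]

variable (L : ℕ) [NeZero L]

/-- **Spin ceiling on the sector ground-state average, any Hamiltonian.** For ANY matrix `H` on the
Fock space of the torus of side `L` and the sector `(2n, S^z = 0)`, the projection `P` onto
`E₀ = szSector 2n 0 ⊓ ker (H - e₀)` satisfies
`Re tr (P Δ_d† Δ_d) ≤ (40 L²/(n+1)) · (n(n+1) · Re tr P - Re tr (P S²))` (average over `E₀` of
`re_normSq_pairField_dWave_mulVec_le_spinDeficit`). Tasaki, Prog. Theor. Phys. 99 (1998) 489, p. 20;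
Tasaki (2020) §2.4. [folklore] -/
theorem re_trace_sectorGroundProj_mul_pairField_dWave_le_spinDeficit
    (H : Matrix (Finset (Orb (FermionTorus 2 L))) (Finset (Orb (FermionTorus 2 L))) ℂ) (n : ℕ)
    (e : ℂ) :
    (projMatrix ((szSector (2 * n) 0 ⊓ Module.End.eigenspace (Matrix.toLin' H) e).map
        (Fock.toEuclidean (ι := Orb (FermionTorus 2 L)) :
          Fock (Orb (FermionTorus 2 L)) →ₗ[ℂ]
            EuclideanSpace ℂ (Finset (Orb (FermionTorus 2 L))))) *
        ((pairField dWaveFormFactor L)ᴴ * pairField dWaveFormFactor L)).trace.re ≤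
      40 * (L : ℝ) ^ 2 / ((n : ℝ) + 1) *
        ((n : ℝ) * (n + 1) *
          (projMatrix ((szSector (2 * n) 0 ⊓ Module.End.eigenspace (Matrix.toLin' H) e).map
            (Fock.toEuclidean (ι := Orb (FermionTorus 2 L)) :
              Fock (Orb (FermionTorus 2 L)) →ₗ[ℂ]
                EuclideanSpace ℂ (Finset (Orb (FermionTorus 2 L)))))).trace.re -
        (projMatrix ((szSector (2 * n) 0 ⊓ Module.End.eigenspace (Matrix.toLin' H) e).map
            (Fock.toEuclidean (ι := Orb (FermionTorus 2 L)) :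
              Fock (Orb (FermionTorus 2 L)) →ₗ[ℂ]
                EuclideanSpace ℂ (Finset (Orb (FermionTorus 2 L))))) *
          (spinSq : Matrix (Finset (Orb (FermionTorus 2 L))) _ ℂ)).trace.re) := by
  rw [map_toEuclidean_eq]
  refine re_trace_projMatrix_mul_le_of_forall_mem_sub _ _ _ _ _ fun v hv => ?_
  have hvS : v ∈ szSector (2 * n) 0 := (Submodule.mem_inf.1 hv).1
  have hsec : IsInSector n n v := (mem_szSector_two_mul_zero_iff n v).1 hvS
  rw [LiebThm1.star_dotProduct_conjTranspose_mul_mulVec]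
  exact re_normSq_pairField_dWave_mulVec_le_spinDeficit L hsec

/-- **Spin ceiling in the crux's vocabulary, every coupling.** For every `δ`, `U`, `L`, the crux's
data satisfy `Re tr (P Δ_d† Δ_d) ≤ (40 L²/(n+1)) (n(n+1) Re tr P - Re tr (P S²))`, `n = ⌊(1-δ)L²/2⌋`
(`N = 2n`). The inner `let`s are the crux's. Tasaki (1998) p. 20. [folklore] -/
theorem re_trace_groundProj_mul_pairField_le_spinDeficit (δ U : ℝ) :
    let N : ℕ := 2 * ⌊(1 - δ) * (L : ℝ) ^ 2 / 2⌋₊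
    let H := hubbardTorus 2 L 1 U
    let S := szSector (Λ := FermionTorus 2 L) N 0
    let E₀ := S ⊓ Module.End.eigenspace (Matrix.toLin' H) ((H.minEnergyOn S : ℝ) : ℂ)
    let P := projMatrix (E₀.map (Fock.toEuclidean (ι := Orb (FermionTorus 2 L)) :
      Fock (Orb (FermionTorus 2 L)) →ₗ[ℂ] EuclideanSpace ℂ (Finset (Orb (FermionTorus 2 L)))))
    (P * ((pairField dWaveFormFactor L)ᴴ * pairField dWaveFormFactor L)).trace.re ≤
      40 * (L : ℝ) ^ 2 / ((⌊(1 - δ) * (L : ℝ) ^ 2 / 2⌋₊ : ℝ) + 1) *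
        ((⌊(1 - δ) * (L : ℝ) ^ 2 / 2⌋₊ : ℝ) * ((⌊(1 - δ) * (L : ℝ) ^ 2 / 2⌋₊ : ℝ) + 1) * P.trace.re -
          (P * (spinSq : Matrix (Finset (Orb (FermionTorus 2 L))) _ ℂ)).trace.re) := by
  intro N H S E₀ P
  exact re_trace_sectorGroundProj_mul_pairField_dWave_le_spinDeficit L H _ _

/-- **The average bound forces a macroscopic spin deficit.** If the crux's ground-state-average
bound `c·L⁴·Re tr P ≤ Re tr (P Δ_d† Δ_d)` holds at ONE datum `(δ, U, c, L)`, then the ground-state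
average of `S²` obeys `Re tr (P S²) ≤ (n+1)(n - c L²/40) · Re tr P`, `n = ⌊(1-δ)L²/2⌋ = N/2 = S_max`:
the mean of `S²` over the ground eigenspace stays BELOW the saturated value `S_max(S_max+1)` by at
least `(S_max + 1) c L²/40`. Tasaki, Prog. Theor. Phys. 99 (1998) 489, p. 20 (no singlet pairing in a
saturated ferromagnet; this is the quantitative form). [folklore] -/
theorem avgBound_re_trace_spinSq_le {δ U c : ℝ}
    (h : let N : ℕ := 2 * ⌊(1 - δ) * (L : ℝ) ^ 2 / 2⌋₊
      let H := hubbardTorus 2 L 1 U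
      let S := szSector (Λ := FermionTorus 2 L) N 0
      let E₀ := S ⊓ Module.End.eigenspace (Matrix.toLin' H) ((H.minEnergyOn S : ℝ) : ℂ)
      let P := projMatrix (E₀.map (Fock.toEuclidean (ι := Orb (FermionTorus 2 L)) :
        Fock (Orb (FermionTorus 2 L)) →ₗ[ℂ] EuclideanSpace ℂ (Finset (Orb (FermionTorus 2 L)))))
      c * (L : ℝ) ^ 4 * P.trace.re ≤
        (P * ((pairField dWaveFormFactor L)ᴴ * pairField dWaveFormFactor L)).trace.re) :
    let N : ℕ := 2 * ⌊(1 - δ) * (L : ℝ) ^ 2 / 2⌋₊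
    let H := hubbardTorus 2 L 1 U
    let S := szSector (Λ := FermionTorus 2 L) N 0
    let E₀ := S ⊓ Module.End.eigenspace (Matrix.toLin' H) ((H.minEnergyOn S : ℝ) : ℂ)
    let P := projMatrix (E₀.map (Fock.toEuclidean (ι := Orb (FermionTorus 2 L)) :
      Fock (Orb (FermionTorus 2 L)) →ₗ[ℂ] EuclideanSpace ℂ (Finset (Orb (FermionTorus 2 L)))))
    (P * (spinSq : Matrix (Finset (Orb (FermionTorus 2 L))) _ ℂ)).trace.re ≤
      ((⌊(1 - δ) * (L : ℝ) ^ 2 / 2⌋₊ : ℝ) + 1) * ((⌊(1 - δ) * (L : ℝ) ^ 2 / 2⌋₊ : ℝ) - c * (L : ℝ) ^ 2 / 40) *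
        P.trace.re := by
  intro N H S E₀ P
  have hup := re_trace_groundProj_mul_pairField_le_spinDeficit L δ U
  simp only at h hup ⊢
  set T := (projMatrix ((szSector (2 * ⌊(1 - δ) * (L : ℝ) ^ 2 / 2⌋₊) 0 ⊓
      Module.End.eigenspace (Matrix.toLin' (hubbardTorus 2 L 1 U))
        (((hubbardTorus 2 L 1 U).minEnergyOn (szSector (2 * ⌊(1 - δ) * (L : ℝ) ^ 2 / 2⌋₊) 0) : ℝ) :
          ℂ)).map (Fock.toEuclidean (ι := Orb (FermionTorus 2 L)) :
      Fock (Orb (FermionTorus 2 L)) →ₗ[ℂ] EuclideanSpace ℂ (Finset (Orb (FermionTorus 2 L)))))).trace.re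
    with hT
  set X := (projMatrix ((szSector (2 * ⌊(1 - δ) * (L : ℝ) ^ 2 / 2⌋₊) 0 ⊓
      Module.End.eigenspace (Matrix.toLin' (hubbardTorus 2 L 1 U))
        (((hubbardTorus 2 L 1 U).minEnergyOn (szSector (2 * ⌊(1 - δ) * (L : ℝ) ^ 2 / 2⌋₊) 0) : ℝ) :
          ℂ)).map (Fock.toEuclidean (ι := Orb (FermionTorus 2 L)) :
      Fock (Orb (FermionTorus 2 L)) →ₗ[ℂ] EuclideanSpace ℂ (Finset (Orb (FermionTorus 2 L))))) *
      (spinSq : Matrix (Finset (Orb (FermionTorus 2 L))) _ ℂ)).trace.re with hX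
  set n : ℕ := ⌊(1 - δ) * (L : ℝ) ^ 2 / 2⌋₊ with hn
  have hL0 : (0 : ℝ) < (L : ℝ) := by exact_mod_cast Nat.pos_of_ne_zero (NeZero.ne L)
  have hL2 : (0 : ℝ) < (L : ℝ) ^ 2 := by positivity
  have hn1 : (0 : ℝ) < (n : ℝ) + 1 := by positivity
  -- `c L⁴ T ≤ (40 L²/(n+1)) (n(n+1) T - X)`, i.e. `c L⁴ T (n+1) ≤ 40 L² (n(n+1) T - X)`
  have h1 : c * (L : ℝ) ^ 4 * T ≤ 40 * (L : ℝ) ^ 2 / ((n : ℝ) + 1) * ((n : ℝ) * (n + 1) * T - X) :=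
    h.trans hup
  rw [div_mul_eq_mul_div, le_div_iff₀ hn1] at h1
  -- divide by `L² > 0`
  have h2 : c * (L : ℝ) ^ 2 * T * ((n : ℝ) + 1) ≤ 40 * ((n : ℝ) * (n + 1) * T - X) := by
    refine le_of_mul_le_mul_right ?_ hL2
    calc c * (L : ℝ) ^ 2 * T * ((n : ℝ) + 1) * (L : ℝ) ^ 2 = c * (L : ℝ) ^ 4 * T * ((n : ℝ) + 1) := by ring
      _ ≤ 40 * (L : ℝ) ^ 2 * ((n : ℝ) * (n + 1) * T - X) := h1
      _ = 40 * ((n : ℝ) * (n + 1) * T - X) * (L : ℝ) ^ 2 := by ring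
  nlinarith

/-- `n = ⌊(1-δ)L²/2⌋ ≤ (1-δ)L²/2`. [folklore] -/
theorem cast_halfPairNumber_le {δ : ℝ} (hδ : δ ≤ 1) (L : ℕ) :
    ((⌊(1 - δ) * (L : ℝ) ^ 2 / 2⌋₊ : ℕ) : ℝ) ≤ (1 - δ) * (L : ℝ) ^ 2 / 2 := by
  refine Nat.floor_le ?_
  have : (0 : ℝ) ≤ (L : ℝ) ^ 2 := by positivity
  have : 0 ≤ 1 - δ := by linarith
  positivity

/-- **Relative form.** Under the same single-datum average bound with `c ≥ 0` and `δ < 1`: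
`Re tr (P S²) ≤ (1 - c/(20(1-δ))) · n(n+1) · Re tr P` — the mean of `S²/(S_max(S_max+1))` over the
ground eigenspace is at most `1 - c/(20(1-δ))` (`n ≤ (1-δ)L²/2`). No `d_{x²-y²}` pair order of density
`c` without a RELATIVE spin deficit of at least `c/(20(1-δ))`. Tasaki (1998) p. 20. [folklore] -/
theorem avgBound_spin_deficit {δ U c : ℝ} (hδm : -1 ≤ δ) (hδ : δ < 1) (hc : 0 ≤ c)
    (h : let N : ℕ := 2 * ⌊(1 - δ) * (L : ℝ) ^ 2 / 2⌋₊
      let H := hubbardTorus 2 L 1 U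
      let S := szSector (Λ := FermionTorus 2 L) N 0
      let E₀ := S ⊓ Module.End.eigenspace (Matrix.toLin' H) ((H.minEnergyOn S : ℝ) : ℂ)
      let P := projMatrix (E₀.map (Fock.toEuclidean (ι := Orb (FermionTorus 2 L)) :
        Fock (Orb (FermionTorus 2 L)) →ₗ[ℂ] EuclideanSpace ℂ (Finset (Orb (FermionTorus 2 L)))))
      c * (L : ℝ) ^ 4 * P.trace.re ≤
        (P * ((pairField dWaveFormFactor L)ᴴ * pairField dWaveFormFactor L)).trace.re) :
    let N : ℕ := 2 * ⌊(1 - δ) * (L : ℝ) ^ 2 / 2⌋₊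
    let H := hubbardTorus 2 L 1 U
    let S := szSector (Λ := FermionTorus 2 L) N 0
    let E₀ := S ⊓ Module.End.eigenspace (Matrix.toLin' H) ((H.minEnergyOn S : ℝ) : ℂ)
    let P := projMatrix (E₀.map (Fock.toEuclidean (ι := Orb (FermionTorus 2 L)) :
      Fock (Orb (FermionTorus 2 L)) →ₗ[ℂ] EuclideanSpace ℂ (Finset (Orb (FermionTorus 2 L)))))
    (P * (spinSq : Matrix (Finset (Orb (FermionTorus 2 L))) _ ℂ)).trace.re ≤
      (1 - c / (20 * (1 - δ))) *
        (((⌊(1 - δ) * (L : ℝ) ^ 2 / 2⌋₊ : ℝ) * ((⌊(1 - δ) * (L : ℝ) ^ 2 / 2⌋₊ : ℝ) + 1))) *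
          P.trace.re := by
  intro N H S E₀ P
  have h1 := avgBound_re_trace_spinSq_le L h
  have hP := one_le_re_trace_groundProj_hubbardTorus L 1 U δ hδm
  simp only at h1 hP ⊢
  refine h1.trans (mul_le_mul_of_nonneg_right ?_ (by linarith))
  -- `(n+1)(n - cL²/40) ≤ (1 - c/(20(1-δ))) n (n+1)` since `n ≤ (1-δ)L²/2`
  have hn := cast_halfPairNumber_le hδ.le L
  have hd : (0 : ℝ) < 1 - δ := by linarith
  have hn0 : (0 : ℝ) ≤ (⌊(1 - δ) * (L : ℝ) ^ 2 / 2⌋₊ : ℝ) := Nat.cast_nonneg _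
  have key : c / (20 * (1 - δ)) * (⌊(1 - δ) * (L : ℝ) ^ 2 / 2⌋₊ : ℝ) ≤ c * (L : ℝ) ^ 2 / 40 := by
    rw [div_mul_eq_mul_div, div_le_div_iff₀ (by positivity) (by norm_num)]
    nlinarith
  nlinarith

/-- **No average pair order on a high-spin ground space.** Contrapositive of
`avgBound_re_trace_spinSq_le`: if the ground-state average of `S²` exceeds
`(n+1)(n - cL²/40) · Re tr P`, the crux's average bound FAILS at `(δ, U, c, L)`. [folklore] -/
theorem not_avgBound_of_re_trace_spinSq_gt {δ U c : ℝ}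
    (hS : let N : ℕ := 2 * ⌊(1 - δ) * (L : ℝ) ^ 2 / 2⌋₊
      let H := hubbardTorus 2 L 1 U
      let S := szSector (Λ := FermionTorus 2 L) N 0
      let E₀ := S ⊓ Module.End.eigenspace (Matrix.toLin' H) ((H.minEnergyOn S : ℝ) : ℂ)
      let P := projMatrix (E₀.map (Fock.toEuclidean (ι := Orb (FermionTorus 2 L)) :
        Fock (Orb (FermionTorus 2 L)) →ₗ[ℂ] EuclideanSpace ℂ (Finset (Orb (FermionTorus 2 L)))))
      ((⌊(1 - δ) * (L : ℝ) ^ 2 / 2⌋₊ : ℝ) + 1) * ((⌊(1 - δ) * (L : ℝ) ^ 2 / 2⌋₊ : ℝ) - c * (L : ℝ) ^ 2 / 40) *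
        P.trace.re < (P * (spinSq : Matrix (Finset (Orb (FermionTorus 2 L))) _ ℂ)).trace.re) :
    ¬ (let N : ℕ := 2 * ⌊(1 - δ) * (L : ℝ) ^ 2 / 2⌋₊
      let H := hubbardTorus 2 L 1 U
      let S := szSector (Λ := FermionTorus 2 L) N 0
      let E₀ := S ⊓ Module.End.eigenspace (Matrix.toLin' H) ((H.minEnergyOn S : ℝ) : ℂ)
      let P := projMatrix (E₀.map (Fock.toEuclidean (ι := Orb (FermionTorus 2 L)) :
        Fock (Orb (FermionTorus 2 L)) →ₗ[ℂ] EuclideanSpace ℂ (Finset (Orb (FermionTorus 2 L)))))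
      c * (L : ℝ) ^ 4 * P.trace.re ≤
        (P * ((pairField dWaveFormFactor L)ᴴ * pairField dWaveFormFactor L)).trace.re) := by
  intro h
  have h1 := avgBound_re_trace_spinSq_le L h
  simp only at h1 hS
  linarith

/-- **Saturated ferromagnetic ground spaces carry no average pair order** (the quantitative form of
the disprover's §6 / route NoGo crux 5): if the ground-state average of `S²` IS the saturated value,
`Re tr (P S²) = n(n+1) Re tr P`, then the average bound fails for every `c > 0`.
Tasaki, Prog. Theor. Phys. 99 (1998) 489, p. 20. [folklore] -/
theorem not_avgBound_of_saturated_groundSpace {δ U c : ℝ} (hδm : -1 ≤ δ) (hc : 0 < c)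
    (hS : let N : ℕ := 2 * ⌊(1 - δ) * (L : ℝ) ^ 2 / 2⌋₊
      let H := hubbardTorus 2 L 1 U
      let S := szSector (Λ := FermionTorus 2 L) N 0
      let E₀ := S ⊓ Module.End.eigenspace (Matrix.toLin' H) ((H.minEnergyOn S : ℝ) : ℂ)
      let P := projMatrix (E₀.map (Fock.toEuclidean (ι := Orb (FermionTorus 2 L)) :
        Fock (Orb (FermionTorus 2 L)) →ₗ[ℂ] EuclideanSpace ℂ (Finset (Orb (FermionTorus 2 L)))))
      (P * (spinSq : Matrix (Finset (Orb (FermionTorus 2 L))) _ ℂ)).trace.re =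
        ((⌊(1 - δ) * (L : ℝ) ^ 2 / 2⌋₊ : ℝ) * ((⌊(1 - δ) * (L : ℝ) ^ 2 / 2⌋₊ : ℝ) + 1)) * P.trace.re) :
    ¬ (let N : ℕ := 2 * ⌊(1 - δ) * (L : ℝ) ^ 2 / 2⌋₊
      let H := hubbardTorus 2 L 1 U
      let S := szSector (Λ := FermionTorus 2 L) N 0
      let E₀ := S ⊓ Module.End.eigenspace (Matrix.toLin' H) ((H.minEnergyOn S : ℝ) : ℂ)
      let P := projMatrix (E₀.map (Fock.toEuclidean (ι := Orb (FermionTorus 2 L)) :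
        Fock (Orb (FermionTorus 2 L)) →ₗ[ℂ] EuclideanSpace ℂ (Finset (Orb (FermionTorus 2 L)))))
      c * (L : ℝ) ^ 4 * P.trace.re ≤
        (P * ((pairField dWaveFormFactor L)ᴴ * pairField dWaveFormFactor L)).trace.re) := by
  refine not_avgBound_of_re_trace_spinSq_gt L ?_
  have hP := one_le_re_trace_groundProj_hubbardTorus L 1 U δ hδm
  simp only at hS hP ⊢
  rw [hS]
  have hL0 : (0 : ℝ) < (L : ℝ) := by exact_mod_cast Nat.pos_of_ne_zero (NeZero.ne L)
  have hL2 : (0 : ℝ) < (L : ℝ) ^ 2 := by positivity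
  have hn0 : (0 : ℝ) ≤ (⌊(1 - δ) * (L : ℝ) ^ 2 / 2⌋₊ : ℝ) := Nat.cast_nonneg _
  nlinarith [mul_pos (mul_pos hc hL2) (by linarith : (0 : ℝ) < (⌊(1 - δ) * (L : ℝ) ^ 2 / 2⌋₊ : ℝ) + 1)]

/-- **Every witness of the crux forces a relative spin deficit `≥ c/(20(1-δ))` on its window.** For
any `(δ, U₁, U₂, c)` with `δ ∈ (0,1/2)`, `0 < c`, for which the crux's average bound holds eventually in
even `L` at every coupling of `(U₁, U₂)`: at every such coupling, eventually in even `L`, the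
ground-state average of `S²` is at most `(1 - c/(20(1-δ))) · n(n+1) · Re tr P` (`n = ⌊(1-δ)L²/2⌋`).
A witness window is therefore disjoint from any phase whose sector ground states are saturated — or
merely `(1 - c/(20(1-δ)))`-nearly saturated on average — ferromagnets (finite-density Nagaoka
ferromagnetism, open: Tasaki, Prog. Theor. Phys. 99 (1998) 489, p. 21). [folklore] -/
theorem birGroundStateAverageLRO_witness_spin_deficit {δ U₁ U₂ c : ℝ}
    (hδ : δ ∈ Set.Ioo (0:ℝ) (1/2)) (hc : 0 < c)
    (h : ∀ U ∈ Set.Ioo U₁ U₂, ∃ L₀ : ℕ, ∀ (L : ℕ) [NeZero L], L₀ ≤ L → Even L →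
      let N : ℕ := 2 * ⌊(1 - δ) * (L : ℝ) ^ 2 / 2⌋₊
      let H := hubbardTorus 2 L 1 U
      let S := szSector (Λ := FermionTorus 2 L) N 0
      let E₀ := S ⊓ Module.End.eigenspace (Matrix.toLin' H) ((H.minEnergyOn S : ℝ) : ℂ)
      let P := projMatrix (E₀.map (Fock.toEuclidean (ι := Orb (FermionTorus 2 L)) :
        Fock (Orb (FermionTorus 2 L)) →ₗ[ℂ] EuclideanSpace ℂ (Finset (Orb (FermionTorus 2 L)))))
      c * (L : ℝ) ^ 4 * P.trace.re ≤
        (P * ((pairField dWaveFormFactor L)ᴴ * pairField dWaveFormFactor L)).trace.re) :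
    ∀ U ∈ Set.Ioo U₁ U₂, ∃ L₀ : ℕ, ∀ (L : ℕ) [NeZero L], L₀ ≤ L → Even L →
      let N : ℕ := 2 * ⌊(1 - δ) * (L : ℝ) ^ 2 / 2⌋₊
      let H := hubbardTorus 2 L 1 U
      let S := szSector (Λ := FermionTorus 2 L) N 0
      let E₀ := S ⊓ Module.End.eigenspace (Matrix.toLin' H) ((H.minEnergyOn S : ℝ) : ℂ)
      let P := projMatrix (E₀.map (Fock.toEuclidean (ι := Orb (FermionTorus 2 L)) :
        Fock (Orb (FermionTorus 2 L)) →ₗ[ℂ] EuclideanSpace ℂ (Finset (Orb (FermionTorus 2 L)))))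
      (P * (spinSq : Matrix (Finset (Orb (FermionTorus 2 L))) _ ℂ)).trace.re ≤
        (1 - c / (20 * (1 - δ))) *
          (((⌊(1 - δ) * (L : ℝ) ^ 2 / 2⌋₊ : ℝ) * ((⌊(1 - δ) * (L : ℝ) ^ 2 / 2⌋₊ : ℝ) + 1))) *
            P.trace.re := by
  intro U hU
  obtain ⟨L₀, hL₀⟩ := h U hU
  refine ⟨L₀, fun L _ hL hE => ?_⟩
  exact avgBound_spin_deficit L (by linarith [hδ.1]) (by linarith [hδ.2]) hc.le (hL₀ L hL hE)

/-- **Conditional reading for the route.** If `BirGroundStateAverageLRO` holds with data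
`(δ, U₁, U₂, c)`, then on the whole window the sector ground states of `hubbardTorus 2 L 1 U` have,
on average over the ground eigenspace and eventually in even `L`, relative total spin-square at most
`1 - c/(20(1-δ)) < 1`: the target EXCLUDES (nearly) saturated ferromagnetism on its window — one more
necessary condition any engine for the target must certify. [folklore] -/
theorem birGroundStateAverageLRO_spin_deficit (h : BirGroundStateAverageLRO) :
    ∃ δ ∈ Set.Ioo (0:ℝ) (1/2), ∃ U₁ U₂ c : ℝ, 0 < U₁ ∧ U₁ < U₂ ∧ 0 < c ∧
      ∀ U ∈ Set.Ioo U₁ U₂, ∃ L₀ : ℕ, ∀ (L : ℕ) [NeZero L], L₀ ≤ L → Even L →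
        let N : ℕ := 2 * ⌊(1 - δ) * (L : ℝ) ^ 2 / 2⌋₊
        let H := hubbardTorus 2 L 1 U
        let S := szSector (Λ := FermionTorus 2 L) N 0
        let E₀ := S ⊓ Module.End.eigenspace (Matrix.toLin' H) ((H.minEnergyOn S : ℝ) : ℂ)
        let P := projMatrix (E₀.map (Fock.toEuclidean (ι := Orb (FermionTorus 2 L)) :
          Fock (Orb (FermionTorus 2 L)) →ₗ[ℂ] EuclideanSpace ℂ (Finset (Orb (FermionTorus 2 L)))))
        (P * (spinSq : Matrix (Finset (Orb (FermionTorus 2 L))) _ ℂ)).trace.re ≤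
          (1 - c / (20 * (1 - δ))) *
            (((⌊(1 - δ) * (L : ℝ) ^ 2 / 2⌋₊ : ℝ) * ((⌊(1 - δ) * (L : ℝ) ^ 2 / 2⌋₊ : ℝ) + 1))) *
              P.trace.re := by
  obtain ⟨δ, hδ, U₁, U₂, c, hU₁, hU, hc, hw⟩ := h
  exact ⟨δ, hδ, U₁, U₂, c, hU₁, hU, hc, birGroundStateAverageLRO_witness_spin_deficit hδ hc hw⟩

/-- Registered one-line form (`--supports stmt-HubbardSuperconductivity-2079`, stub
`spinWitnessCeiling`): every witness `(δ, U₁, U₂, c)` of the crux, `0 < c`, forces at every coupling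
of its window, eventually in even `L`, the ground-state-average relative spin deficit
`⟨S²⟩ ≤ (1 - c/(20(1-δ))) · n(n+1)`, `n = ⌊(1-δ)L²/2⌋`. Tasaki, Prog. Theor. Phys. 99 (1998) 489,
p. 20. [folklore] -/
theorem spinWitnessCeiling : ∀ (δ U₁ U₂ c : ℝ), δ ∈ Set.Ioo (0:ℝ) (1/2) → 0 < c → (∀ U ∈ Set.Ioo U₁ U₂, ∃ L₀ : ℕ, ∀ (L : ℕ) [NeZero L], L₀ ≤ L → Even L → (let N : ℕ := 2 * ⌊(1 - δ) * (L : ℝ) ^ 2 / 2⌋₊; let H := Literature.MathematicalPhysics.QuantumLattice.hubbardTorus 2 L 1 U; let S := Literature.MathematicalPhysics.QuantumLattice.szSector (Λ := Literature.MathematicalPhysics.QuantumLattice.FermionTorus 2 L) N 0; let E₀ := S ⊓ Module.End.eigenspace (Matrix.toLin' H) ((H.minEnergyOn S : ℝ) : ℂ); let P := Literature.MathematicalPhysics.QuantumLattice.projMatrix (E₀.map (Literature.MathematicalPhysics.QuantumLattice.Fock.toEuclidean (ι := Literature.MathematicalPhysics.QuantumLattice.Orb (Literature.MathematicalPhysics.QuantumLattice.FermionTorus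 2 L)) : Literature.MathematicalPhysics.QuantumLattice.Fock (Literature.MathematicalPhysics.QuantumLattice.Orb (Literature.MathematicalPhysics.QuantumLattice.FermionTorus 2 L)) →ₗ[ℂ] EuclideanSpace ℂ (Finset (Literature.MathematicalPhysics.QuantumLattice.Orb (Literature.MathematicalPhysics.QuantumLattice.FermionTorus 2 L))))); c * (L : ℝ) ^ 4 * P.trace.re ≤ (P * (Matrix.conjTranspose (Literature.MathematicalPhysics.QuantumLattice.pairField Literature.MathematicalPhysics.QuantumLattice.dWaveFormFactor L) * Literature.MathematicalPhysics.QuantumLattice.pairField Literature.MathematicalPhysics.QuantumLattice.dWaveFormFactor L)).trace.re)) → ∀ U ∈ Set.Ioo U₁ U₂, ∃ L₀ : ℕ, ∀ (L : ℕ) [NeZero L], L₀ ≤ L → Even L → (let N : ℕ := 2 * ⌊(1 - δ) * (L : ℝ) ^ 2 / 2⌋₊; let H := Literature.MathematicalPhysics.QuantumLattice.hubbardTorus 2 L 1 U; let S := Literature.MathematicalPhysics.QuantumLattice.szSector (Λ := Literature.MathematicalPhysics.QuantumLattice.FermionTorus 2 L) N 0; let E₀ := S ⊓ Module.End.eigenspace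 (Matrix.toLin' H) ((H.minEnergyOn S : ℝ) : ℂ); let P := Literature.MathematicalPhysics.QuantumLattice.projMatrix (E₀.map (Literature.MathematicalPhysics.QuantumLattice.Fock.toEuclidean (ι := Literature.MathematicalPhysics.QuantumLattice.Orb (Literature.MathematicalPhysics.QuantumLattice.FermionTorus 2 L)) : Literature.MathematicalPhysics.QuantumLattice.Fock (Literature.MathematicalPhysics.QuantumLattice.Orb (Literature.MathematicalPhysics.QuantumLattice.FermionTorus 2 L)) →ₗ[ℂ] EuclideanSpace ℂ (Finset (Literature.MathematicalPhysics.QuantumLattice.Orb (Literature.MathematicalPhysics.QuantumLattice.FermionTorus 2 L))))); (P * Literature.MathematicalPhysics.QuantumLattice.spinSq).trace.re ≤ (1 - c / (20 * (1 - δ))) * (((⌊(1 - δ) * (L : ℝ) ^ 2 / 2⌋₊ : ℝ) * ((⌊(1 - δ) * (L : ℝ) ^ 2 / 2⌋₊ : ℝ) + 1))) * P.trace.re) :=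
  fun _ _ _ _ hδ hc h => birGroundStateAverageLRO_witness_spin_deficit hδ hc h

end CruxFormat

end Summit.HubbardSuperconductivity.HubbardSuperconductivity.Theorems.BirGroundStateAverageLRO.Negative
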